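import Literature.NumberTheory.Rogawski1990.FinExplicitTransferFactorStableInvariance   -- ★ p839998: `finGammaTwo`∕`finCharpolyTwo` are stable class functions; `isLocalNormPair_iff_of_isLocalStablyConjH`
import Literature.NumberTheory.Rogawski1990.EndoscopicClassTransfer                      -- ★ `charpoly_endoGL`, `isStablyConj_iff_eq_of_fin_one` (rational templates §4–§5)
import Literature.LinearAlgebra.Matrix.RegularSemisimpleConjClassClosed                   -- ★ `exists_units_conj_eq_of_charpoly_eq_of_separable` over `Π_i K_i`
import HarnessLib

/-!
# The NORM FIBRE of a regular class at a finite place: at most three stable classes of `H_v = U(2) × U(1)` match a given `G`-regular class of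
# `G′_v = U(H′)(L⁺_v)`, and they are told apart by the `U(1)`-slot (Rogawski 1990, §4.3 (4.3.1)–(4.3.2) p. 43, §5.4 p. 78)

Topic `NumberTheory/Rogawski1990`; namespace `Literature.NumberTheory.Rogawski1990`.  THEOREMS ONLY (no definition, no instance, no notation, no named fact,
no `sorry`; Mathlib-only footing; count-neutral for the books).  Cell `pub/hodgecm-mathlib` (D-0151), crux H413 = stmt-HodgeConjecture-24833, F0∕P3a road «D-N6-ns»,
floor-1 target «N6-ns-reg» (local Δ-transfer for regular-supported test functions at a non-split place), brick **(J-d-2) «NORM FIBRE ≤ 3»** of F0P3a-p08 (g13)'s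
ledger `F0/P3a/F0P3a-p08/g13/LEDGER-N6ns-floor1.F0P3a-p08g13.md` §2; consumer = F0P2-p02 (g8)'s junction `Rogawski1990/LocalTransferChartJunctionCM.lean`
(heads (F1)–(F3) agreed on the bus 2026-09-01T02:39:42Z).  HONEST LABEL: HC_CM is proved only modulo the printed citations until rung 0 closes; this file proves no
letter — it is the local class bookkeeping that tells the junction HOW MANY `H`-boxes a `G′`-chart needs (the one-box form of the `G′`-side vanishing hypothesis
`hzeroG` is false at the tori of type `(L_w¹)³`: print's (4.3.1) prescribes `Φ^st(·, ψ^H)` on every `H`-stable class over the `G′`-stable class).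

THE MATHEMATICS.  `H_v = U(Φ₂)(L⁺_v) × U(Φ₁)(L⁺_v) ⊂ GL₂(E_v) × GL₁(E_v)`, `E_v = Π_{w ∣ v} L_w` (★ `UnitaryGroup.LocalRing`); `γ_H = (g, u)`; `ι_v(γ_H) = g ⊕ u`
(★ `endoEmbLocal`, ★ `coe_endoEmbLocal`).  Matching ★ `IsLocalNormPair L H′ v γ_H γ` is conjugacy of `ι_v(γ_H)` and `γ` in `GL₃(E_v)`; stable conjugacy in `H_v`
★ `IsLocalStablyConjH` is conjugacy in `GL₂(E_v) × GL₁(E_v)`.  Hence `charpoly γ = χ_g · (X − u)` on a matching pair (§1), so `u` is a ROOT of `charpoly γ`; two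
`G`-regular `γ_H, γ_H′` matching the same `γ` with the same `u` have `χ_g = χ_{g′}` (cancel the monic `X − u`), `χ_g` separable, hence `g ∼ g′` in `GL₂(Π L_w)`
(★ `exists_units_conj_eq_of_charpoly_eq_of_separable`, place by place) — they are STABLY CONJUGATE (§2, (F2)); so inside a norm fibre stable conjugacy is read
on the `U(1)`-slot alone (§3, (F3)), and the fibre has finitely many stable classes — one per admissible root `u`, at most `3` at a non-split `v` where `E_v = L_w`
is a field (§4, (F1)).  Print [Rogawski1990 §5.4 p. 78]: «there are three stable conjugacy classes in `H` … which transfer to `γ₀`» (type `(E¹)³`); one for the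
other matched torus types; none when `charpoly γ` has no norm-one root in `L_w` (cubic-field tori).  The RATIONAL-points twins (`[Infinite F]`, via `F̄` and
similarity cancellation) are ★ `StableClassH.eq_of_transfersTo_of_sndVal_eq` ∕ `ncard_setOf_transfersTo_le_three`; the local proof below is regularity-driven
instead and holds at EVERY finite place for §1–§3 and the finiteness in §4.

* §1 `charpoly_endoEmbLocal`, `IsLocalNormPair.charpoly_eq`, `IsLocalNormPair.isRoot_finGammaTwo`, `IsLocalNormPair.isRegularElt`, `IsLocalGRegular.separable_finCharpolyTwo`,
  `snd_eq_iff_finGammaTwo_eq`.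
* §2 (F2) `isLocalStablyConjH_of_isLocalNormPair_of_finGammaTwo_eq`, `isLocalStablyConjH_of_isLocalNormPair_of_snd_eq`.
* §3 (F3) `IsLocalStablyConjH.snd_eq`, `IsLocalStablyConjH.finGammaTwo_eq`, `isLocalStablyConjH_iff_snd_eq_of_isLocalNormPair`, `isLocalStablyConjH_iff_finGammaTwo_eq_of_isLocalNormPair`.
* §4 (F1) `finite_image_finGammaTwo_normFibre`, `exists_finset_normFibre_card_le`, `exists_finset_normFibre` (every finite `v`), `exists_finset_normFibre_card_le_three` (non-split `v`).

## References
* [Rogawski1990] J. D. Rogawski, *Automorphic Representations of Unitary Groups in Three Variables*, Ann. of Math. Stud. 123 (1990): §3.1 p. 19 (stable conjugacy =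
  `GL_n`-conjugacy), §4.3 (4.3.1)–(4.3.2) pp. 42–43 (`γ_H → γ`, `Φ^st` on the `H`-side), §5.4 p. 78 (three stable classes of `H` over a class of type `(E¹)³`).
* [LanglandsShelstad1987] R. P. Langlands, D. Shelstad, *On the definition of transfer factors*, Math. Ann. 278 (1987), §1.3.
* [HornJohnson2013] R. A. Horn, C. R. Johnson, *Matrix Analysis*, 2nd ed. (2013), 3.3.P12 (nonderogatory matrices with equal characteristic polynomial are similar).
-/

set_option autoImplicit false

noncomputable section

open NumberField IsDedekindDomain Matrix Polynomial
open scoped MatrixGroups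

namespace Literature.NumberTheory.Rogawski1990

open Literature.NumberTheory.Automorphic

variable (L : Type) [Field L] [NumberField L] [IsCMField L] (H' : Matrix (Fin 3) (Fin 3) L) (v : HeightOneSpectrum (𝓞 ↥(maximalRealSubfield L)))

/-! ## §1 `charpoly γ = χ_g · (X − u)` on a matching pair; `u` is a root; regularity bookkeeping -/

section Charpoly

variable {a a' : (UnitaryGroup.cmDatum L 2 (Matrix.of fun i j : Fin 2 => if i.val + j.val + 1 = 2 then (1 : L) else 0)).Local v ×
      (UnitaryGroup.cmDatum L 1 (Matrix.of fun i j : Fin 1 => if i.val + j.val + 1 = 1 then (1 : L) else 0)).Local v}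
  {γ : (UnitaryGroup.cmDatum L 3 H').Local v}

/-- **`charpoly ι_v(γ_H) = χ_g · (X − u)`** for `γ_H = (g, u) ∈ H_v` (★ `charpoly_endoGL`; the `1 × 1` block contributes `X − u`).
[cite: Rogawski1990, §4.3 p. 42] -/
theorem charpoly_endoEmbLocal
    (a : (UnitaryGroup.cmDatum L 2 (Matrix.of fun i j : Fin 2 => if i.val + j.val + 1 = 2 then (1 : L) else 0)).Local v ×
      (UnitaryGroup.cmDatum L 1 (Matrix.of fun i j : Fin 1 => if i.val + j.val + 1 = 1 then (1 : L) else 0)).Local v) :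
    ((endoEmbLocal L v a).val.val : Matrix (Fin 3) (Fin 3) (UnitaryGroup.LocalRing L v)).charpoly =
      finCharpolyTwo L v a * (X - C (finGammaTwo L v a)) := by
  change ((endoGL ((a.1.val : GL (Fin 2) (UnitaryGroup.LocalRing L v)), (a.2.val : GL (Fin 1) (UnitaryGroup.LocalRing L v)))).val).charpoly = _
  rw [charpoly_endoGL]
  unfold finCharpolyTwo finGammaTwo
  congr 1
  rw [Matrix.charpoly, Matrix.det_fin_one, Matrix.charmatrix_apply_eq]

/-- **`charpoly γ = χ_g · (X − u)` on a matching pair `ι_v(γ_H) ↔ γ`** (conjugate matrices in `GL₃(E_v)` have the same characteristic polynomial).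
[cite: Rogawski1990, §4.3 p. 43; §14.1 p. 232] -/
theorem IsLocalNormPair.charpoly_eq (h : IsLocalNormPair L H' v a γ) :
    ((γ.val : GL (Fin 3) (UnitaryGroup.LocalRing L v)) : Matrix (Fin 3) (Fin 3) (UnitaryGroup.LocalRing L v)).charpoly =
      finCharpolyTwo L v a * (X - C (finGammaTwo L v a)) := by
  rw [isLocalNormPair_iff] at h
  rw [← h.charpoly_eq, charpoly_endoEmbLocal]

/-- **The `U(1)`-slot `u` of a matching `γ_H` is a root of `charpoly γ`.** [cite: Rogawski1990, §5.4 p. 78; §4.3 p. 43] -/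
theorem IsLocalNormPair.isRoot_finGammaTwo (h : IsLocalNormPair L H' v a γ) :
    (((γ.val : GL (Fin 3) (UnitaryGroup.LocalRing L v)) : Matrix (Fin 3) (Fin 3) (UnitaryGroup.LocalRing L v)).charpoly).IsRoot (finGammaTwo L v a) := by
  rw [h.charpoly_eq, IsRoot, eval_mul, eval_sub, eval_X, eval_C, sub_self, mul_zero]

/-- A `G`-regular `γ_H` matches only REGULAR `γ` (same separable characteristic polynomial). [cite: Rogawski1990, §4.3 p. 42] -/
theorem IsLocalNormPair.isRegularElt (ha : IsLocalGRegular L v a) (h : IsLocalNormPair L H' v a γ) :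
    IsRegularElt (γ.val : GL (Fin 3) (UnitaryGroup.LocalRing L v)) := by
  rw [isRegularElt_iff, h.charpoly_eq, ← charpoly_endoEmbLocal]
  exact ha

/-- `G`-regularity of `γ_H = (g, u)` read on `χ_g · (X − u)`. [cite: Rogawski1990, §4.3 p. 42] -/
theorem IsLocalGRegular.separable_mul (ha : IsLocalGRegular L v a) : (finCharpolyTwo L v a * (X - C (finGammaTwo L v a))).Separable := by
  rw [← charpoly_endoEmbLocal]
  exact ha

/-- `G`-regularity of `γ_H = (g, u)` makes `χ_g` separable. [cite: Rogawski1990, §4.3 p. 42] -/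
theorem IsLocalGRegular.separable_finCharpolyTwo (ha : IsLocalGRegular L v a) : (finCharpolyTwo L v a).Separable :=
  (ha.separable_mul L v).of_mul_left

/-- The `U(Φ₁)`-components agree iff their entries `u = (γ₁)₀₀` agree (a `1 × 1` invertible matrix is its entry). [cite: Rogawski1990, §4.9 p. 55] -/
theorem snd_eq_iff_finGammaTwo_eq : a.2 = a'.2 ↔ finGammaTwo L v a = finGammaTwo L v a' := by
  constructor
  · intro h
    unfold finGammaTwo
    rw [h]
  · intro h
    unfold finGammaTwo at h
    refine Subtype.ext (Units.ext (Matrix.ext fun i j => ?_))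
    fin_cases i; fin_cases j
    exact h

end Charpoly

/-! ## §2 (F2) Two `G`-regular preimages of one class with the same `U(1)`-slot are stably conjugate -/

section TwoPreimages

variable {a a' : (UnitaryGroup.cmDatum L 2 (Matrix.of fun i j : Fin 2 => if i.val + j.val + 1 = 2 then (1 : L) else 0)).Local v ×
      (UnitaryGroup.cmDatum L 1 (Matrix.of fun i j : Fin 1 => if i.val + j.val + 1 = 1 then (1 : L) else 0)).Local v}
  {γ : (UnitaryGroup.cmDatum L 3 H').Local v}

/-- **(F2) Same target class, same `u` ⇒ stably conjugate.**  If `γ_H = (g, u)` is `G`-regular and `γ_H`, `γ_H′ = (g′, u′)` both match `γ ∈ G′_v` with `u = u′`,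
then `γ_H ∼_st γ_H′` in `H_v`: `χ_g · (X − u) = charpoly γ = χ_{g′} · (X − u)`, cancel the monic factor, and two elements of `GL₂(Π_{w∣v} L_w)` with the same
SEPARABLE characteristic polynomial are conjugate (★ `exists_units_conj_eq_of_charpoly_eq_of_separable`).  Every finite `v`, split or not.
[cite: Rogawski1990, §5.4 p. 78; §3.1 p. 19] [cite: HornJohnson2013, 3.3.P12] -/
theorem isLocalStablyConjH_of_isLocalNormPair_of_finGammaTwo_eq (ha : IsLocalGRegular L v a) (h : IsLocalNormPair L H' v a γ)
    (h' : IsLocalNormPair L H' v a' γ) (hu : finGammaTwo L v a = finGammaTwo L v a') : IsLocalStablyConjH L v a a' := by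
  -- `χ_g · (X − u) = χ_{g′} · (X − u)`
  have hχ : finCharpolyTwo L v a * (X - C (finGammaTwo L v a)) = finCharpolyTwo L v a' * (X - C (finGammaTwo L v a)) := by
    conv_rhs => rw [hu]
    rw [← h.charpoly_eq, ← h'.charpoly_eq]
  -- cancel the monic linear factor
  have hχ₂ : finCharpolyTwo L v a = finCharpolyTwo L v a' := (monic_X_sub_C (finGammaTwo L v a)).isRegular.right hχ
  -- `χ_g` separable, so `g ∼ g′` in `GL₂(Π_{w∣v} L_w)`
  obtain ⟨c, hc⟩ := Literature.LinearAlgebra.Matrix.exists_units_conj_eq_of_charpoly_eq_of_separable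
    (K := fun w : UnitaryGroup.PlacesOver L v => w.1.adicCompletion L)
    (a.1.val : GL (Fin 2) (UnitaryGroup.LocalRing L v)) (a'.1.val : GL (Fin 2) (UnitaryGroup.LocalRing L v))
    (ha.separable_finCharpolyTwo) (by unfold finCharpolyTwo at hχ₂; exact hχ₂.symm)
  refine ⟨isConj_iff.2 ⟨c, hc⟩, ?_⟩
  rw [(snd_eq_iff_finGammaTwo_eq L v).2 hu]
  exact IsStablyConj.refl _

/-- **(F2), slot form**: `G`-regular `γ_H`, `γ_H′` matching the same `γ` with equal `U(Φ₁)`-components are stably conjugate. [cite: Rogawski1990, §5.4 p. 78] -/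
theorem isLocalStablyConjH_of_isLocalNormPair_of_snd_eq (ha : IsLocalGRegular L v a) (h : IsLocalNormPair L H' v a γ)
    (h' : IsLocalNormPair L H' v a' γ) (hu : a.2 = a'.2) : IsLocalStablyConjH L v a a' :=
  isLocalStablyConjH_of_isLocalNormPair_of_finGammaTwo_eq L H' v ha h h' ((snd_eq_iff_finGammaTwo_eq L v).1 hu)

end TwoPreimages

/-! ## §3 (F3) Inside a norm fibre, stable conjugacy is decided by the `U(1)`-slot -/

section Slot

variable {a t : (UnitaryGroup.cmDatum L 2 (Matrix.of fun i j : Fin 2 => if i.val + j.val + 1 = 2 then (1 : L) else 0)).Local v ×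
      (UnitaryGroup.cmDatum L 1 (Matrix.of fun i j : Fin 1 => if i.val + j.val + 1 = 1 then (1 : L) else 0)).Local v}
  {γ : (UnitaryGroup.cmDatum L 3 H').Local v}

/-- Stably conjugate elements of `H_v` have EQUAL `U(Φ₁)`-components (`GL₁` is abelian; ★ `isStablyConj_iff_eq_of_fin_one`). [cite: Rogawski1990, §3.1 p. 19] -/
theorem IsLocalStablyConjH.snd_eq (hst : IsLocalStablyConjH L v a t) : a.2 = t.2 :=
  isStablyConj_iff_eq_of_fin_one.1 hst.2

/-- … and equal entries `u`. [cite: Rogawski1990, §3.1 p. 19] -/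
theorem IsLocalStablyConjH.finGammaTwo_eq (hst : IsLocalStablyConjH L v a t) : finGammaTwo L v a = finGammaTwo L v t :=
  (snd_eq_iff_finGammaTwo_eq L v).1 (hst.snd_eq L v)

/-- **(F3) THE `U(1)`-SLOT CRITERION.**  For `G`-regular `γ_H` and `γ_H`, `t` both matching `γ`: `γ_H ∼_st t ↔` their `U(Φ₁)`-components are equal.
[cite: Rogawski1990, §5.4 p. 78; §3.1 p. 19] -/
theorem isLocalStablyConjH_iff_snd_eq_of_isLocalNormPair (ha : IsLocalGRegular L v a) (h : IsLocalNormPair L H' v a γ) (ht : IsLocalNormPair L H' v t γ) :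
    IsLocalStablyConjH L v a t ↔ a.2 = t.2 :=
  ⟨fun hst => hst.snd_eq L v, fun hu => isLocalStablyConjH_of_isLocalNormPair_of_snd_eq L H' v ha h ht hu⟩

/-- **(F3), entry form**: `γ_H ∼_st t ↔ u(γ_H) = u(t)` inside the fibre. [cite: Rogawski1990, §5.4 p. 78] -/
theorem isLocalStablyConjH_iff_finGammaTwo_eq_of_isLocalNormPair (ha : IsLocalGRegular L v a) (h : IsLocalNormPair L H' v a γ)
    (ht : IsLocalNormPair L H' v t γ) : IsLocalStablyConjH L v a t ↔ finGammaTwo L v a = finGammaTwo L v t :=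
  ⟨fun hst => hst.finGammaTwo_eq L v, fun hu => isLocalStablyConjH_of_isLocalNormPair_of_finGammaTwo_eq L H' v ha h ht hu⟩

end Slot

/-! ## §4 (F1) The norm fibre has finitely many stable classes — at most three at a non-split place -/

section Fibre

/-- **The `u`-values of a norm fibre are finite**: the entries `u(γ_H)` of the `G`-regular `γ_H ∈ H_v` matching a fixed `γ ∈ G′_v` lie, place by place, among
the roots of `charpoly γ` in the fields `L_w` (`w ∣ v`). [cite: Rogawski1990, §5.4 p. 78] -/
theorem finite_image_finGammaTwo_normFibre (γ : (UnitaryGroup.cmDatum L 3 H').Local v) :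
    (finGammaTwo L v ''
      {a : (UnitaryGroup.cmDatum L 2 (Matrix.of fun i j : Fin 2 => if i.val + j.val + 1 = 2 then (1 : L) else 0)).Local v ×
          (UnitaryGroup.cmDatum L 1 (Matrix.of fun i j : Fin 1 => if i.val + j.val + 1 = 1 then (1 : L) else 0)).Local v |
        IsLocalGRegular L v a ∧ IsLocalNormPair L H' v a γ}).Finite := by
  classical
  set p : Polynomial (UnitaryGroup.LocalRing L v) :=
    ((γ.val : GL (Fin 3) (UnitaryGroup.LocalRing L v)) : Matrix (Fin 3) (Fin 3) (UnitaryGroup.LocalRing L v)).charpoly with hp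
  have hp0 : ∀ w : UnitaryGroup.PlacesOver L v, p.map (Pi.evalRingHom (fun w : UnitaryGroup.PlacesOver L v => w.1.adicCompletion L) w) ≠ 0 :=
    fun w => ((Matrix.charpoly_monic _).map _).ne_zero
  refine (Set.Finite.pi' (ι := UnitaryGroup.PlacesOver L v)
    (t := fun w => (((p.map (Pi.evalRingHom (fun w : UnitaryGroup.PlacesOver L v => w.1.adicCompletion L) w)).roots.toFinset :
      Finset (w.1.adicCompletion L)) : Set (w.1.adicCompletion L)))
    fun w => Finset.finite_toSet _).subset ?_
  rintro u ⟨a, ⟨-, hmatch⟩, rfl⟩ w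
  rw [Finset.mem_coe, Multiset.mem_toFinset, Polynomial.mem_roots (hp0 w)]
  exact (IsLocalNormPair.isRoot_finGammaTwo L H' v hmatch).map

/-- **The representatives, with the cardinality bookkeeping** `S.card ≤ #(u-values of the fibre)`: one `G`-regular matching representative per value of the
`U(1)`-slot, pairwise not stably conjugate, exhausting the fibre up to stable conjugacy (every finite `v`). [cite: Rogawski1990, §5.4 p. 78] -/
theorem exists_finset_normFibre_card_le (γ : (UnitaryGroup.cmDatum L 3 H').Local v) :
    ∃ S : Finset ((UnitaryGroup.cmDatum L 2 (Matrix.of fun i j : Fin 2 => if i.val + j.val + 1 = 2 then (1 : L) else 0)).Local v ×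
        (UnitaryGroup.cmDatum L 1 (Matrix.of fun i j : Fin 1 => if i.val + j.val + 1 = 1 then (1 : L) else 0)).Local v),
      S.card ≤ (finite_image_finGammaTwo_normFibre L H' v γ).toFinset.card ∧
      (∀ t ∈ S, IsLocalGRegular L v t ∧ IsLocalNormPair L H' v t γ) ∧
      (∀ t ∈ S, ∀ t' ∈ S, t ≠ t' → ¬ IsLocalStablyConjH L v t t') ∧
      ∀ a, IsLocalGRegular L v a → IsLocalNormPair L H' v a γ → ∃ t ∈ S, IsLocalStablyConjH L v a t := by
  classical
  set M : Set ((UnitaryGroup.cmDatum L 2 (Matrix.of fun i j : Fin 2 => if i.val + j.val + 1 = 2 then (1 : L) else 0)).Local v ×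
        (UnitaryGroup.cmDatum L 1 (Matrix.of fun i j : Fin 1 => if i.val + j.val + 1 = 1 then (1 : L) else 0)).Local v) :=
    {a | IsLocalGRegular L v a ∧ IsLocalNormPair L H' v a γ} with hM
  have hUfin : (finGammaTwo L v '' M).Finite := finite_image_finGammaTwo_normFibre L H' v γ
  haveI : Nonempty ((UnitaryGroup.cmDatum L 2 (Matrix.of fun i j : Fin 2 => if i.val + j.val + 1 = 2 then (1 : L) else 0)).Local v ×
        (UnitaryGroup.cmDatum L 1 (Matrix.of fun i j : Fin 1 => if i.val + j.val + 1 = 1 then (1 : L) else 0)).Local v) := ⟨1⟩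
  -- one representative per value of `u`
  have hrep : ∀ u ∈ finGammaTwo L v '' M, ∃ a ∈ M, finGammaTwo L v a = u := fun u hu => hu
  choose! rep hrepM hrepu using hrep
  refine ⟨hUfin.toFinset.image rep, Finset.card_image_le, ?_, ?_, ?_⟩
  · intro t ht
    obtain ⟨u, hu, rfl⟩ := Finset.mem_image.1 ht
    exact hrepM u (hUfin.mem_toFinset.1 hu)
  · intro t ht t' ht' hne hst
    obtain ⟨u, hu, rfl⟩ := Finset.mem_image.1 ht
    obtain ⟨u', hu', rfl⟩ := Finset.mem_image.1 ht'
    have e := hst.finGammaTwo_eq L v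
    rw [hrepu u (hUfin.mem_toFinset.1 hu), hrepu u' (hUfin.mem_toFinset.1 hu')] at e
    exact hne (by rw [e])
  · intro a ha hmatch
    have hu : finGammaTwo L v a ∈ finGammaTwo L v '' M := ⟨a, ⟨ha, hmatch⟩, rfl⟩
    exact ⟨rep (finGammaTwo L v a), Finset.mem_image.2 ⟨_, hUfin.mem_toFinset.2 hu, rfl⟩,
      isLocalStablyConjH_of_isLocalNormPair_of_finGammaTwo_eq L H' v ha hmatch (hrepM _ hu).2 (hrepu _ hu).symm⟩

/-- **(F1) THE NORM FIBRE AS A FINITE SET OF REPRESENTATIVES** (every finite `v`).  For `γ ∈ G′_v = U(H′)(L⁺_v)` there is a finite set `S ⊂ H_v` of `G`-regular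
elements matching `γ`, PAIRWISE NOT stably conjugate, such that every `G`-regular `γ_H` matching `γ` is stably conjugate to some `t ∈ S` (one representative per
admissible value of the `U(1)`-slot; `S = ∅` when no `G`-regular `γ_H` matches `γ`, e.g. at the cubic-field tori).  This is the index set of the `H`-boxes of one
`G′`-chart in the (4.3.1) junction (★ `exists_transfer_of_boxes_of_realisation`). [cite: Rogawski1990, §5.4 p. 78; §4.3 (4.3.1) p. 43] [cite: LanglandsShelstad1987, §1.3] -/
theorem exists_finset_normFibre (γ : (UnitaryGroup.cmDatum L 3 H').Local v) :
    ∃ S : Finset ((UnitaryGroup.cmDatum L 2 (Matrix.of fun i j : Fin 2 => if i.val + j.val + 1 = 2 then (1 : L) else 0)).Local v ×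
        (UnitaryGroup.cmDatum L 1 (Matrix.of fun i j : Fin 1 => if i.val + j.val + 1 = 1 then (1 : L) else 0)).Local v),
      (∀ t ∈ S, IsLocalGRegular L v t ∧ IsLocalNormPair L H' v t γ) ∧
      (∀ t ∈ S, ∀ t' ∈ S, t ≠ t' → ¬ IsLocalStablyConjH L v t t') ∧
      ∀ a, IsLocalGRegular L v a → IsLocalNormPair L H' v a γ → ∃ t ∈ S, IsLocalStablyConjH L v a t := by
  obtain ⟨S, -, hS⟩ := exists_finset_normFibre_card_le L H' v γ
  exact ⟨S, hS⟩

/-- **(F1) AT A NON-SPLIT PLACE: AT MOST THREE.**  If `v` has ONE place `w` of `L` above it (`E_v = L_w` a field), the representatives can be taken with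
`S.card ≤ 3`: the `u`-values of the fibre are distinct roots in `L_w` of the cubic `charpoly γ` («three stable conjugacy classes in `H` which transfer to `γ₀`» for
type `(E¹)³`, one for the other matched types, none otherwise). [cite: Rogawski1990, §5.4 p. 78; §3.6 p. 31] -/
theorem exists_finset_normFibre_card_le_three (hv : Subsingleton (UnitaryGroup.PlacesOver L v)) (γ : (UnitaryGroup.cmDatum L 3 H').Local v) :
    ∃ S : Finset ((UnitaryGroup.cmDatum L 2 (Matrix.of fun i j : Fin 2 => if i.val + j.val + 1 = 2 then (1 : L) else 0)).Local v ×
        (UnitaryGroup.cmDatum L 1 (Matrix.of fun i j : Fin 1 => if i.val + j.val + 1 = 1 then (1 : L) else 0)).Local v),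
      S.card ≤ 3 ∧
      (∀ t ∈ S, IsLocalGRegular L v t ∧ IsLocalNormPair L H' v t γ) ∧
      (∀ t ∈ S, ∀ t' ∈ S, t ≠ t' → ¬ IsLocalStablyConjH L v t t') ∧
      ∀ a, IsLocalGRegular L v a → IsLocalNormPair L H' v a γ → ∃ t ∈ S, IsLocalStablyConjH L v a t := by
  classical
  obtain ⟨S, hcard, hS⟩ := exists_finset_normFibre_card_le L H' v γ
  refine ⟨S, hcard.trans ?_, hS⟩
  -- the `u`-values inject (evaluation at the unique `w`) into the roots of `charpoly γ` in `L_w`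
  obtain ⟨w₀⟩ := UnitaryGroup.PlacesOver.nonempty L v
  set p : Polynomial (UnitaryGroup.LocalRing L v) :=
    ((γ.val : GL (Fin 3) (UnitaryGroup.LocalRing L v)) : Matrix (Fin 3) (Fin 3) (UnitaryGroup.LocalRing L v)).charpoly with hp
  set f := Pi.evalRingHom (fun w : UnitaryGroup.PlacesOver L v => w.1.adicCompletion L) w₀ with hf
  have hpm : (p.map f).Monic := (Matrix.charpoly_monic _).map f
  calc (finite_image_finGammaTwo_normFibre L H' v γ).toFinset.card
      ≤ (p.map f).roots.toFinset.card := by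
        refine Finset.card_le_card_of_injOn f (fun u hu => ?_) (fun u _ u' _ huu' => funext fun w => ?_)
        · obtain ⟨a, ⟨-, hmatch⟩, rfl⟩ := (Set.Finite.mem_toFinset _).1 hu
          rw [Finset.mem_coe, Multiset.mem_toFinset, Polynomial.mem_roots hpm.ne_zero]
          exact (IsLocalNormPair.isRoot_finGammaTwo L H' v hmatch).map
        · rw [Subsingleton.elim w w₀]
          exact huu'
    _ ≤ (p.map f).natDegree := (Multiset.toFinset_card_le _).trans (Polynomial.card_roots' _)
    _ = 3 := by rw [(Matrix.charpoly_monic _).natDegree_map, Matrix.charpoly_natDegree_eq_dim, Fintype.card_fin]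

end Fibre

end Literature.NumberTheory.Rogawski1990

end
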